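import Summits.QuantumFields.YangMills.Theorems.BalabanUVNodesN15KingModelGraphTreeDecayContinuumDensity
import Summits.QuantumFields.YangMills.Theorems.BalabanUVNodesN15KingModelGraphTreeDecayContinuumNE2
import Summits.QuantumFields.YangMills.Theorems.BalabanUVNodesN15KingModelGraphTreeDecayContinuumLegsInf
import Summits.QuantumFields.YangMills.Theorems.BalabanUVNodesN15KingModelGraphTreeDecayTriangleSummed

/-!
# BalabanUVNodes ∕ N15 — THE KING-MODEL RUNG (PART Β-w): THE TRIANGLE DIAGRAM END TO END — A NON-DEGENERATE, HYPOTHESIS-FREE WITNESS OF PARTS Β-d…Β-j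
# (vacuum amplitude, vacuum energy density, two-point kernel with its limit and decay, NE2's unit layer against the continuum kernel, the three-point kernel with
# tree decay) FOR KING's ONE-LOOP TRIANGLE `△` AT `A = 0`, `d + 1 = 4`
# (Track A, DAG node N15 = NE2; FAN-OUT v1.1 §N15 s3 «KING-MODEL RUNG … NE2's analogue DECIDED in the model»)

HONEST FRAMING.  Count-neutral (cell `pub-ymgap`, seat `pub-ymgap-dag-n15-e` g31; `--supports stmt-QuantumFields-27366 --as helper` = K3⁸
`SpineGivenEndpointR13SepCoPHV`).  TEMPLATE LITERATURE: C. King, *The U(1) Higgs model. I. The continuum limit*, Commun. Math. Phys. **102** (1986) 649–677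
[King1986] — KING's OWN `A = 0` MODEL.  NOT Bałaban's `G(U)`; NOT a node discharge (N15 is booked through n15-a's knit, untouched here); nothing continuum ∕ ℝ⁴ ∕
OS ∕ mass-gap ∕ Clay («continuum kernel» = the `K → ∞` limit of King's lattice diagrams at fixed unit lattice, Theorem 2.1's `lim_{κ→∞}`).  0 `sorry`; standard
axioms.

WHY THIS FILE (referee act-(iv) reads of parts Β-f₁∕Β-i, ref-K READ-551∕553, ref-J READ-519∕520, 2026-08-29: «A2 EXHIBITED (degenerate): empty-graph witness; a
non-degenerate instance (a real line and ≥ 2 legs) needs a `PosSubgraphsBy` + `PosDegrees` certificate — the triangle `posSubgraphsBy_triangle_lineExp` exists in-tree,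
cited by name, not instantiated»).  This file INSTANTIATES it: King's triangle `△` (three vertices, three `G`-lines `triSrc = ![0,0,1]`, `triTgt = ![1,2,2]`, part
Γ-j; connected by `lConn_triangle`, p. 664's sentence by `posSubgraphsBy_triangle_lineExp`, (3.77) along every ordering by `posDegrees_kingDegList_triangle`) is fed
through every universal statement of parts Β-d…Β-j, leaving theorems with NO graph hypothesis: the `K → ∞` limits EXIST for a genuinely interacting (one-loop)
diagram with real lines and legs, with the printed shapes of Theorem 2.1 (i)∕(ii), Theorem 3.4 (3.9), Lemma 4.5 (4.38), (3.6) and (3.38).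

WHAT THIS FILE PROVES (kernel; 0 `def`; `d = 3`, i.e. King's `d + 1 = 4`; `L` odd `≥ 3`, `a > 0`, `0 < m² ≤ m₀²`, any volume exponent `e_M`).
★ `king_triangle_vacuum_continuumLimit` (Thm 2.1 (i) + Thm 3.4 (3.9)'s extensive rate for `E^{(K+1)}(△)`), ★★ `king_triangle_density_continuumLimit` (the vacuum
energy density of `△` converges, volume-free rate AND volume-free bound — (2.23)'s content), ★★ `king_triangle_twoPoint_continuumLimit` (the two-point kernel
`E^{(K+1)}(△; y_b, y_{b′})` converges with Lemma 4.5 (4.38)'s shape `C·L^{−γ(K+1)}·e^{−δ|b−b′|_T}`, legs of any kinds at the vertices `0`, `v₁`),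
★ `king_triangle_twoPoint_limit_decay` ((3.6)'s shape for the limit), ★★★ **`ne2PlusUnit_king_triangle`** (NE2's unit-layer predicate `T4EtaRate.NE2PlusUnit` INHABITED
by the triangle's composite kernel against its continuum limit — «NE2_in_KingModel» for an interacting diagram, no hypothesis), ★★ `king_triangle_threePoint_continuumLimit`
∕ ★★ `king_triangle_threePoint_limit_treeDecayInf` (one leg at each vertex: the three-point kernel converges and its limit decays in the FULL-rate tree length
`d_tree^{(∞)}` of part Β-j — (3.38)∕(3.56)'s `exp[−δ·(tree length)]`).

HONEST SCOPE.  Instances of parts Β-d…Β-j at one graph; constants are theirs (`A, γ, δ, C₁, C₂, Q` depend on `L, a, m₀²` only); torus ∕ periodic b.c.; `A = 0`;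
N15 untouched; counts unmoved.
Locators: [King1986] Thm 2.1 (2.22)–(2.23) p.654, (3.6) p.656, Thm 3.4 (3.9) p.656, (3.38) p.660, Prop. 3.6 (3.56) p.662, p.664, (3.77) p.666, Lemma 4.5 (4.38) p.674.
-/

noncomputable section

open scoped BigOperators Topology
open Finset Filter

namespace Summit.QuantumFields.YangMills.BalabanUVNodes.N15KingModelRung.Curved

open Literature.MathematicalPhysics.QuantumFieldTheory.Balaban1983to89
open Literature.MathematicalPhysics.QuantumFieldTheory.Balaban1983to89.B5Prop11Plancherel (Tor fine)
open Literature.MathematicalPhysics.QuantumFieldTheory.Balaban1983to89.T4EtaRate (EtaRateIneqUnit NE2PlusUnit)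
open Literature.MathematicalPhysics.QuantumFieldTheory.King1986.Torus (tdistT tdistT_nonneg)
open Summit.QuantumFields.YangMills.BalabanUVNodes.N15KingModelRung (KingVolIndex kingVol kingVol_neZero kingVolInstance kingUnitDist)
open Summit.QuantumFields.YangMills.BalabanUVNodes.N15KingModelRung.Graph

variable (L : ℕ) [NeZero L]

/-! ## §1 The vacuum triangle: amplitude and energy density -/

section Vacuum

/-- ★ **THE VACUUM TRIANGLE CONVERGES, WITH (3.9)'s EXTENSIVE RATE — NO HYPOTHESIS**: for `L` odd `≥ 3`, `a > 0`, `m₀² ≥ 0` there are `A ≥ 1`, `γ > 0` with: for every mass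
`0 < m² ≤ m₀²` and volume exponent `e_M`, `lim_K E^{(K+1)}(△)` exists and `|E^{(K+1)}(△) − E^{(∞)}(△)| ≤ (2L^{e_M})⁴·L^{−γ}·(24A⁹)·(L^{−γ})^K∕(1 − L^{−γ})`.
[cite: King1986, Thm 2.1 (i) (2.22) p.654, Thm 3.4 (3.9) p.656, (3.35) p.659, p.664] -/
theorem king_triangle_vacuum_continuumLimit (hLodd : Odd L) (hL : 2 ≤ L) {a : ℝ} (ha : 0 < a) {m0sq : ℝ} (hm0 : 0 ≤ m0sq) :
    ∃ A γ : ℝ, 1 ≤ A ∧ 0 < γ ∧ ∀ (msq : ℝ), 0 < msq → msq ≤ m0sq → ∀ (eM : ℕ),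
      ∃ Einf : ℝ, Tendsto (kingVacuumSeq L a msq eM 2 3 triSrc triTgt (fun _ => (none : Option (Fin (3 + 1))))) atTop (𝓝 Einf) ∧
        ∀ K : ℕ, |kingVacuumSeq L a msq eM 2 3 triSrc triTgt (fun _ => (none : Option (Fin (3 + 1)))) K - Einf|
          ≤ (((2 * (L : ℝ) ^ eM) ^ (3 + 1) * (L : ℝ) ^ (-γ) * (24 * A ^ 9)) * ((L : ℝ) ^ (-γ)) ^ K) / (1 - (L : ℝ) ^ (-γ)) := by
  obtain ⟨A, γ, hA, hγ, H⟩ := king_vacuum_graph_continuumLimit (d := 3) L hLodd hL ha hm0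
  refine ⟨A, γ, hA, hγ, fun msq hm hcap eM => ?_⟩
  obtain ⟨E, hE, hrate⟩ := H msq hm hcap eM 2 3 triSrc triTgt lConn_triangle _ posSubgraphsBy_triangle_lineExp
  refine ⟨E, hE, fun K => (hrate K).trans (le_of_eq ?_)⟩
  norm_num [Nat.factorial]
  ring

/-- ★★ **THE TRIANGLE's VACUUM ENERGY DENSITY CONVERGES, VOLUME-FREE RATE AND VOLUME-FREE BOUND — NO HYPOTHESIS** ((2.23)'s content for `△`):
`|e_K(△) − e_∞(△)| ≤ L^{−γ}·24A⁹·(L^{−γ})^K∕(1 − L^{−γ})` and `|e_∞(△)| ≤ A⁶·Σ_π degConst L (kingDegList △ π)`. [cite: King1986, Thm 2.1 (ii) (2.23) p.654, Thm 3.4 (3.9) p.656, (3.77) p.666] -/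
theorem king_triangle_density_continuumLimit (hLodd : Odd L) (hL : 2 ≤ L) {a : ℝ} (ha : 0 < a) {m0sq : ℝ} (hm0 : 0 ≤ m0sq) :
    ∃ A γ : ℝ, 1 ≤ A ∧ 0 < γ ∧ ∀ (msq : ℝ), 0 < msq → msq ≤ m0sq → ∀ (eM : ℕ),
      ∃ einf : ℝ, Tendsto (kingVacuumDensity L a msq eM 2 3 triSrc triTgt (fun _ => (none : Option (Fin (3 + 1))))) atTop (𝓝 einf) ∧
        (∀ K : ℕ, |kingVacuumDensity L a msq eM 2 3 triSrc triTgt (fun _ => (none : Option (Fin (3 + 1)))) K - einf|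
          ≤ ((L : ℝ) ^ (-γ) * (24 * A ^ 9)) * ((L : ℝ) ^ (-γ)) ^ K / (1 - (L : ℝ) ^ (-γ))) ∧
        |einf| ≤ A ^ 6 * ∑ π : Equiv.Perm (Fin 3),
          degConst L (kingDegList triSrc triTgt (((3 : ℕ) + 1 : ℕ) : ℝ) (fun ℓ => lineExp (3 + 1) ((fun _ : Fin 3 => (none : Option (Fin (3 + 1)))) ℓ)) π) := by
  obtain ⟨A, γ, hA, hγ, H⟩ := king_vacuum_density_continuumLimit (d := 3) L hLodd hL ha hm0
  refine ⟨A, γ, hA, hγ, fun msq hm hcap eM => ?_⟩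
  obtain ⟨e, he, hrate, hbd⟩ := H msq hm hcap eM 2 3 triSrc triTgt lConn_triangle _ posSubgraphsBy_triangle_lineExp posDegrees_kingDegList_triangle
  refine ⟨e, he, fun K => (hrate K).trans (le_of_eq ?_), hbd.trans (le_of_eq ?_)⟩
  · norm_num [Nat.factorial]; ring
  · norm_num

end Vacuum

/-! ## §2 The triangle's two-point kernel: limit, rate with decay, decay of the limit, NE2's unit layer -/

section TwoPoint

/-- ★★ **THE TRIANGLE's TWO-POINT KERNEL CONVERGES WITH LEMMA 4.5 (4.38)'s SHAPE — NO HYPOTHESIS**: legs of kinds `κ₀, κ₁` from the vertices `0`, `v₁` to the unit sites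
`b, b′`; `|E^{(K+1)}(△; y_b, y_{b′}) − E^{(∞)}(△; b, b′)| ≤ (e^{δ}·216A^{10}·L^{−γ}·e^{−δ|b−b′|_T})·(L^{−γ})^K∕(1 − L^{−γ})`.
[cite: King1986, Thm 2.1 (i) (2.22) p.654, Prop. 3.6 (3.56) p.662, Lemma 4.5 (4.38) p.674] -/
theorem king_triangle_twoPoint_continuumLimit (hLodd : Odd L) (hL : 2 ≤ L) {a : ℝ} (ha : 0 < a) {m0sq : ℝ} (hm0 : 0 ≤ m0sq) :
    ∃ A γ δ : ℝ, 1 ≤ A ∧ 0 < γ ∧ 0 < δ ∧ ∀ (msq : ℝ), 0 < msq → msq ≤ m0sq →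
      ∀ (eM : ℕ) (v₁ : Fin (2 + 1)) (κ₀ κ₁ : Option (Fin (3 + 1))) (b b' : Tor (kingVol L (jvSucc (d := 3) eM 0))),
      ∃ Einf : ℝ, Tendsto (kingPairSeq L a msq eM 2 3 triSrc triTgt (fun _ => (none : Option (Fin (3 + 1)))) v₁ κ₀ κ₁ b b') atTop (𝓝 Einf) ∧
        ∀ K : ℕ,
          haveI := kingVol_neZero L (jvSucc (d := 3) eM 0)
          |kingPairSeq L a msq eM 2 3 triSrc triTgt (fun _ => (none : Option (Fin (3 + 1)))) v₁ κ₀ κ₁ b b' K - Einf|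
            ≤ ((Real.exp δ * (36 * A ^ 10)) * (L : ℝ) ^ (-γ)
                * Real.exp (-(δ * tdistT (kingVol L (jvSucc (d := 3) eM 0)) b b'))) * ((L : ℝ) ^ (-γ)) ^ K / (1 - (L : ℝ) ^ (-γ)) := by
  obtain ⟨A, γ, δ, hA, hγ, hδ, H⟩ := king_graphPair_continuumLimit (d := 3) L hLodd hL ha hm0
  refine ⟨A, γ, δ, hA, hγ, hδ, fun msq hm hcap eM v₁ κ₀ κ₁ b b' => ?_⟩
  obtain ⟨E, hE, hrate⟩ := H msq hm hcap eM 2 3 triSrc triTgt lConn_triangle _ posSubgraphsBy_triangle_lineExp v₁ κ₀ κ₁ b b'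
  refine ⟨E, hE, fun K => (hrate K).trans (le_of_eq ?_)⟩
  norm_num [Nat.factorial]
  ring

/-- ★ **THE TRIANGLE's CONTINUUM TWO-POINT KERNEL DECAYS EXPONENTIALLY, UNIFORMLY IN THE VOLUME — NO HYPOTHESIS** ((3.6)'s shape):
`|E^{(∞)}(△; b, b′)| ≤ (Q·c368 3 δ)·(C₁³C₂²·(Σ_π degConst L (kingDegList △ π))·Q)·e^{δ}·e^{−δ|b−b′|_T}`. [cite: King1986, Thm 3.3 (3.6) p.656, Prop. 3.6 (3.56) p.662] -/
theorem king_triangle_twoPoint_limit_decay (hLodd : Odd L) (hL : 2 ≤ L) {a : ℝ} (ha : 0 < a) {m0sq : ℝ} (hm0 : 0 ≤ m0sq) :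
    ∃ C₁ C₂ Q δ : ℝ, 0 < C₁ ∧ 0 < C₂ ∧ 0 < Q ∧ 0 < δ ∧ ∀ (msq : ℝ), 0 < msq → msq ≤ m0sq →
      ∀ (eM : ℕ) (v₁ : Fin (2 + 1)) (κ₀ κ₁ : Option (Fin (3 + 1))) (b b' : Tor (kingVol L (jvSucc (d := 3) eM 0))),
      ∀ Einf : ℝ, Tendsto (kingPairSeq L a msq eM 2 3 triSrc triTgt (fun _ => (none : Option (Fin (3 + 1)))) v₁ κ₀ κ₁ b b') atTop (𝓝 Einf) →
        haveI := kingVol_neZero L (jvSucc (d := 3) eM 0)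
        |Einf| ≤ ((Q * c368 3 δ) * (C₁ ^ 3 * C₂ ^ 2
                * (∑ π : Equiv.Perm (Fin 3), degConst L (kingDegList triSrc triTgt ((3 + 1 : ℕ) : ℝ)
                    (fun ℓ => lineExp (3 + 1) ((fun _ : Fin 3 => (none : Option (Fin (3 + 1)))) ℓ)) π)) * Q))
              * (Real.exp δ * Real.exp (-(δ * tdistT (kingVol L (jvSucc (d := 3) eM 0)) b b'))) := by
  obtain ⟨C₁, C₂, Q, δ, hC₁, hC₂, hQ, hδ, H⟩ := king_graphPair_limit_decay (d := 3) L hLodd hL ha hm0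
  exact ⟨C₁, C₂, Q, δ, hC₁, hC₂, hQ, hδ, fun msq hm hcap eM v₁ κ₀ κ₁ b b' E hE =>
    H msq hm hcap eM 2 3 triSrc triTgt lConn_triangle _ posSubgraphsBy_triangle_lineExp v₁ κ₀ κ₁ b b' E hE⟩

/-- ★★★ **NE2's UNIT-LAYER PREDICATE INHABITED BY AN INTERACTING DIAGRAM — NO HYPOTHESIS**: for `L` odd `≥ 3`, `a > 0`, `0 < m² ≤ m₀²`, every second-leg vertex `v₁`,
leg kinds `κ₀, κ₁` and every `c35`, the triangle's composite two-point kernel against its continuum limit, on the family `(e_M, K) ↦ kingVolInstance 3 L (jvSucc e_M K)`,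
satisfies `T4EtaRate.NE2PlusUnit` (part Β-f₂ `ne2PlusUnit_kingGraph_limit` at `△`). [cite: Balaban1985BackgroundPropagators, Thm 3.15 (3.187) p.432 (shape); King1986, Lemma 4.5 (4.38) p.674, Prop. 3.6 (3.56) p.662] -/
theorem ne2PlusUnit_king_triangle (hLodd : Odd L) (hL : 2 ≤ L) {a : ℝ} (ha : 0 < a) {m0sq msq : ℝ} (hm0 : 0 ≤ m0sq) (hm : 0 < msq) (hcap : msq ≤ m0sq)
    (v₁ : Fin (2 + 1)) (κ₀ κ₁ : Option (Fin (3 + 1))) (c35 : ℝ) :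
    NE2PlusUnit c35 (fun p : ℕ × ℕ => kingVolInstance 3 L (jvSucc (d := 3) p.1 p.2))
      (kingGraphLimUnit L a msq 2 3 triSrc triTgt (fun _ => (none : Option (Fin (3 + 1)))) v₁ κ₀ κ₁)
      (fun _ _ => True) (fun p => kingUnitDist L (jvSucc (d := 3) p.1 p.2)) :=
  ne2PlusUnit_kingGraph_limit L hLodd hL ha hm0 hm hcap lConn_triangle posSubgraphsBy_triangle_lineExp v₁ κ₀ κ₁ c35

end TwoPoint

/-! ## §3 The triangle's three-point kernel (one leg at each vertex): limit and full-rate tree decay -/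

section ThreePoint

/-- ★★ **THE TRIANGLE's THREE-POINT KERNEL CONVERGES — NO HYPOTHESIS**: one leg at each vertex (`vtx = id`, kinds `κe`, unit sites `b : Fin 3 → T`), with the pair-decay
rate of part Β-h in every pair of legs. [cite: King1986, Thm 2.1 (i) (2.22) p.654, Prop. 3.6 (3.56) p.662, Prop. 3.8 (3.71) p.664] -/
theorem king_triangle_threePoint_continuumLimit (hLodd : Odd L) (hL : 2 ≤ L) {a : ℝ} (ha : 0 < a) {m0sq : ℝ} (hm0 : 0 ≤ m0sq) :
    ∃ A γ δ : ℝ, 1 ≤ A ∧ 0 < γ ∧ 0 < δ ∧ ∀ (msq : ℝ), 0 < msq → msq ≤ m0sq →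
      ∀ (eM : ℕ) (b : Fin 3 → Tor (kingVol L (jvSucc (d := 3) eM 0))) (κe : Fin 3 → Option (Fin (3 + 1))),
      ∃ Einf : ℝ, Tendsto (kingLegSeq L a msq eM 2 3 triSrc triTgt (fun _ => (none : Option (Fin (3 + 1)))) (Fin 3) (fun υ => υ) b κe) atTop (𝓝 Einf) ∧
        ∀ (υ₁ υ₂ : Fin 3) (K : ℕ),
          haveI := kingVol_neZero L (jvSucc (d := 3) eM 0)
          |kingLegSeq L a msq eM 2 3 triSrc triTgt (fun _ => (none : Option (Fin (3 + 1)))) (Fin 3) (fun υ => υ) b κe K - Einf|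
            ≤ ((Real.exp δ * A ^ (2 * 3 + 2 + Fintype.card (Fin 3)) * (((3 : ℕ).factorial : ℝ) * (3 + Fintype.card (Fin 3) + 1))) * (L : ℝ) ^ (-γ)
                * Real.exp (-(δ * tdistT (kingVol L (jvSucc (d := 3) eM 0)) (b υ₁) (b υ₂)))) * ((L : ℝ) ^ (-γ)) ^ K / (1 - (L : ℝ) ^ (-γ)) := by
  obtain ⟨A, γ, δ, hA, hγ, hδ, H⟩ := king_graphLegs_continuumLimit (d := 3) L hLodd hL ha hm0
  exact ⟨A, γ, δ, hA, hγ, hδ, fun msq hm hcap eM b κe =>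
    H msq hm hcap eM 2 3 triSrc triTgt lConn_triangle _ posSubgraphsBy_triangle_lineExp (Fin 3) (fun υ => υ) 0 rfl b κe⟩

/-- ★★ **THE TRIANGLE's CONTINUUM THREE-POINT KERNEL DECAYS IN THE FULL-RATE TREE LENGTH — NO HYPOTHESIS** ((3.38)∕(3.56)'s `exp[−δ·d_tree]` with part Β-j's
`d_tree^{(∞)} = kingTreeDistInf`): `|E^{(∞)}(△; {b_υ})| ≤ (Q·c368 3 δ)·(C₁³C₂²·(Σ_π degConst)·Q²)·exp[−δ·d_tree^{(∞)}({b_υ})]`.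
[cite: King1986, Thm 3.5 (3.38) p.660, Prop. 3.6 (3.56) p.662, p.664] -/
theorem king_triangle_threePoint_limit_treeDecayInf (hLodd : Odd L) (hL : 2 ≤ L) {a : ℝ} (ha : 0 < a) {m0sq : ℝ} (hm0 : 0 ≤ m0sq) :
    ∃ C₁ C₂ Q δ : ℝ, 0 < C₁ ∧ 0 < C₂ ∧ 0 < Q ∧ 0 < δ ∧ ∀ (msq : ℝ), 0 < msq → msq ≤ m0sq →
      ∀ (eM : ℕ) (b : Fin 3 → Tor (kingVol L (jvSucc (d := 3) eM 0))) (κe : Fin 3 → Option (Fin (3 + 1))),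
      ∀ Einf : ℝ, Tendsto (kingLegSeq L a msq eM 2 3 triSrc triTgt (fun _ => (none : Option (Fin (3 + 1)))) (Fin 3) (fun υ => υ) b κe) atTop (𝓝 Einf) →
        |Einf| ≤ ((Q * c368 3 δ) * (C₁ ^ 3 * C₂ ^ 2
                * (∑ π : Equiv.Perm (Fin 3), degConst L (kingDegList triSrc triTgt ((3 + 1 : ℕ) : ℝ)
                    (fun ℓ => lineExp (3 + 1) ((fun _ : Fin 3 => (none : Option (Fin (3 + 1)))) ℓ)) π))
                * Q ^ (Fintype.card (Fin 3) - 1))) * Real.exp (-(δ * kingTreeDistInf L eM b)) := by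
  obtain ⟨C₁, C₂, Q, δ, hC₁, hC₂, hQ, hδ, H⟩ := king_graphLegs_limit_treeDecayInf (d := 3) L hLodd hL ha hm0
  exact ⟨C₁, C₂, Q, δ, hC₁, hC₂, hQ, hδ, fun msq hm hcap eM b κe E hE =>
    H msq hm hcap eM 2 3 triSrc triTgt lConn_triangle _ posSubgraphsBy_triangle_lineExp (Fin 3) (fun υ => υ) 0 rfl b κe E hE⟩

end ThreePoint

end Summit.QuantumFields.YangMills.BalabanUVNodes.N15KingModelRung.Curved

end
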